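import Summits.QuantumFields.YangMills.Theorems.BalabanUVNodesN15KingModelThm33AtRegularFieldRegionDatumAlong

/-!
# Route «BalabanUVNodes», node N15 = NE2 — THE KING-MODEL RUNG, PART Θ⁺⁺-b: KING 1986 THEOREM 3.3 ON A BIG-BLOCK REGION `Ω ⊊ T_ε` AT A REGULAR
# BACKGROUND — THE UNIT-LATTICE CLAUSES: (3.6) for `Δ^{(k)}(Ω, A)`, `C^{(k)}(Ω, A)` and the LIVE clause for `δC^{(k)}(Ω, A) = C^{(k)}(Ω, A) − C^{(k)}(A)`

Cell `pub-ymgap`, Track A (D-0062), seat `pub-ymgap-dag-n15-e` (R141 (C), s3), generation 21; second file of PART Θ⁺⁺ (datum: `…RegionDatum`).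
`bears_on: R4∕N15`; `--supports stmt-QuantumFields-27366` (K3⁸, `--as helper`).  COUNT-NEUTRAL.  Namespace `…N15KingModelRung.Curved`.

WHAT THIS FILE PROVES (0 `sorry`, no `def`).  ★★ `region_unit_clauses`: for `L` odd `> 1`, `a, m² > 0`, `N`, `(e, q)` there are `K₀min` and, for every
cube size `K₀ ≥ K₀min` with `L ∣ K₀`, a threshold `t > 0` such that for every cubic torus of r14's sub-family (`Shape P`, `K₀ ∣ M`, `3K₀ ≤ 2M`), every level
`1 ≤ k < K_P` with `L^kε ≤ 1`, every big-block union `Ω`, every field `A` with one-step differences `≤ δ`, `L^k·δ·|e| ≤ t`, there are `C₁, δ₁ > 0` such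
that for all `C ≥ C₁`, `0 < δ₀ ≤ δ₁` and EVERY fine carrier `V` and contour system `Γ` the datum `D = kingThm33DataAlong C P k Ω V Γ A a m²` satisfies the three unit-lattice bounds of
`ContinuumLimit.Thm33Printed`: `Decay36 D.distk C δ₀ D.lapK`, `Decay36 D.distk C δ₀ D.covK`, and
`|D.δcovK x y| ≤ C e^{−δ₀|x−y|} e^{−δ₀ dist({x,y}, ∂Ω)}`.  SOURCES, BY NAME: (3.6) for `Δ^{(k)}(Ω, A)` ⇐ r14
`B1Prop23RegularRegion.ineq227_regular_region_uniform` ([Ba1] (2.27) on `Ω`); (3.6) for `C^{(k)}(Ω, A)` ⇐ `B1Prop23RegularRegionSmall.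
prop23_regular_region_small` ((2.34) on `Ω`, one-piece tower `regTower Ω`); the `δC` clause ⇐ `B1Ineq238RegularRegionSmall.prop23_238_regular_region_small`
((2.38): `C^{(k)}_{Ω^{(k)}}(Ω, A) − C^{(k)}_{Ω^{(k)}}(T, A)`, towers `regTower Ω ⊆ regTower T`) + `B1Props21to23RegularTorus.ineq234_236_regular_torus_std`
((2.36) on `T`: `C^{(k)}_{Ω^{(k)}}(T, A) − C^{(k)}(T, A) = δC^{(k)}_{Ω^{(k)}}(T, A)` by `condCov232_univ`), the two pieces added under the `ℓ¹` block norm and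
the weight `e^{−δ(|x−y| + d(x) + d(y))} ≤ e^{−δ|x−y|} e^{−δ min(d(x), d(y))}`.  [cite: King1986, Thm 3.3 (3.6) p.656]
[cite: Balaban1982Higgs1, Prop. 2.2 (2.27) p.611, Prop. 2.3 (2.34)–(2.38) pp.611–612] [cite: Balaban1983RegularityDecay, Prop. 2.3 (1.15)–(1.20) p.574]

HONEST FRAMING ∕ SCOPE.  A KNIT; no estimate is new; hypotheses and scope exactly as in `…RegionDatum` (interior carrier, `L ∣ K₀`, cubic tori, `m² > 0`,
`1 ≤ k < K_P`, `L^kε ≤ 1`); the smallness `d²·ε|e|·L^{2k}·δ ≤ 1∕3` of (2.27) is derived from `L^k·δ·|e| ≤ 1∕(3(d²+1))` and `L^kε ≤ 1`.  NOT Bałaban's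
non-abelian `G(U)`; NE2⁺ NOT printed ∕ not proved; NOT a node discharge; counts untouched; nothing continuum ∕ ℝ⁴ ∕ OS ∕ mass-gap ∕ Clay.
-/

noncomputable section

open scoped BigOperators

namespace Summit.QuantumFields.YangMills.BalabanUVNodes.N15KingModelRung.Curved

open Literature.MathematicalPhysics.QuantumFieldTheory.Balaban1983to89
open Literature.MathematicalPhysics.QuantumFieldTheory.Balaban1983to89.HiggsLattice (ChargeData covDeriv)
open Literature.MathematicalPhysics.QuantumFieldTheory.Balaban1983to89.HiggsAveraging (blockIter)
open Literature.MathematicalPhysics.QuantumFieldTheory.Balaban1983to89.HiggsCondCov232 (condCov232 deltaCov235 condCov232_univ)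
open Literature.MathematicalPhysics.QuantumFieldTheory.Balaban1983to89.B1Eq230FluctCov (mat Ix deltaKA fluctCovA)
open Literature.MathematicalPhysics.QuantumFieldTheory.Balaban1983to89.B1Eq211ZeroFieldTorus (Shape)
open Literature.MathematicalPhysics.QuantumFieldTheory.Balaban1983to89.B1TorusRegionHSizes (IsBigBlockUnion isBigBlockUnion_univ)
open Literature.MathematicalPhysics.QuantumFieldTheory.Balaban1983to89.B1Ineq234Concrete (distC distC_nonneg)
open Literature.MathematicalPhysics.QuantumFieldTheory.Balaban1983to89.B2Eq328ConcretePieces (pieceF)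
open Literature.MathematicalPhysics.QuantumFieldTheory.Balaban1983to89.B1Prop23RegularRegion (ineq227_regular_region_uniform)
open Literature.MathematicalPhysics.QuantumFieldTheory.Balaban1983to89.B1Prop23RegularRegionSmall (prop23_regular_region_small)
open Literature.MathematicalPhysics.QuantumFieldTheory.Balaban1983to89.B1Ineq238RegularRegionSmall (prop23_238_regular_region_small)
open Literature.MathematicalPhysics.QuantumFieldTheory.Balaban1983to89.B1Props21to23RegularTorus (ineq234_236_regular_torus_std)
open Literature.MathematicalPhysics.QuantumFieldTheory.King1986.ContinuumLimit (Thm33Data Thm33Printed Decay36)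

variable {N : ℕ}

/-- ★★ **THE UNIT-LATTICE CLAUSES OF KING 1986 THEOREM 3.3 ON A BIG-BLOCK REGION AT A REGULAR BACKGROUND** — (3.6) for `Δ^{(k)}(Ω, A)` and
`C^{(k)}(Ω, A)`, and the LIVE clause `|δC^{(k)}(Ω, A)(x, y)| ≤ C e^{−δ₀|x−y|} e^{−δ₀ dist({x,y}, ∂Ω)}` for the datum `kingThm33DataAlong` (every fine carrier `V`, every contour system `Γ`), with
constants monotone-ready (`∀ C ≥ C₁, 0 < δ₀ ≤ δ₁`) for the assembly of PART Θ⁺⁺-d (statement and sources in the module docstring).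
[cite: King1986, Thm 3.3 (3.6) p.656] [cite: Balaban1982Higgs1, Prop. 2.2 (2.27) p.611, Prop. 2.3 (2.34)–(2.38) pp.611–612]
[cite: Balaban1983RegularityDecay, Prop. 2.3 (1.15)–(1.20) p.574] -/
theorem region_unit_clauses (d L : ℕ) (hL : Odd L ∧ 1 < L) {a msq : ℝ} (ha : 0 < a) (hmsq : 0 < msq) (N : ℕ) (C : ChargeData N) :
    ∃ K₀min : ℕ, ∀ K₀ : ℕ, K₀min ≤ K₀ → L ∣ K₀ → ∃ t : ℝ, 0 < t ∧
      ∀ (P : HiggsLattice.Params) (_S : Shape P), P.d = d → P.L = L → K₀ ∣ P.M → 3 * K₀ ≤ 2 * P.M →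
      ∀ {k : ℕ}, 1 ≤ k → k < P.K → P.mesh k ≤ 1 →
      ∀ (Ω : Finset (HiggsLattice.Site P 0)), IsBigBlockUnion k K₀ Ω → ∀ (V : Finset (HiggsLattice.Site P 0)),
      ∀ (Γ : HiggsLattice.Site P 0 → HiggsLattice.Site P 0 → List (HiggsLattice.Site P 0)),
      ∀ (A : HiggsLattice.VecField P 0) {δ : ℝ}, 0 ≤ δ →
        (∀ (z : HiggsLattice.Site P 0) (μ ν : Fin P.d), |A ⟨z.shift ν, μ⟩ - A ⟨z, μ⟩| ≤ δ) →
        (P.L : ℝ) ^ k * δ * |C.e| ≤ t →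
        ∃ C₁ δ₁ : ℝ, 0 < C₁ ∧ 0 < δ₁ ∧ ∀ (Cc δ₀ : ℝ), C₁ ≤ Cc → 0 < δ₀ → δ₀ ≤ δ₁ →
          Decay36 (kingThm33DataAlong C P k Ω V Γ A a msq).distk Cc δ₀ (kingThm33DataAlong C P k Ω V Γ A a msq).lapK ∧
          Decay36 (kingThm33DataAlong C P k Ω V Γ A a msq).distk Cc δ₀ (kingThm33DataAlong C P k Ω V Γ A a msq).covK ∧
          (∀ x y, |(kingThm33DataAlong C P k Ω V Γ A a msq).δcovK x y|
              ≤ Cc * Real.exp (-(δ₀ * (kingThm33DataAlong C P k Ω V Γ A a msq).distk x y))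
                * Real.exp (-(δ₀ * (kingThm33DataAlong C P k Ω V Γ A a msq).dbdryk x y))) := by
  have hL1 : 1 < L := hL.2
  obtain ⟨t₁, c₁, δ₁, ht₁, hc₁, hδ₁, hCov⟩ := prop23_regular_region_small d L hL1 ha hmsq N
  obtain ⟨t₂, c₂, δ₂, ht₂, hc₂, hδ₂, hCov238⟩ := prop23_238_regular_region_small d L hL1 ha hmsq N
  obtain ⟨K₆, tT, cT, δT, hTpos, hCovT⟩ := ineq234_236_regular_torus_std d L hL ha hmsq N C
  refine ⟨max K₆ 1, fun K₀ hK₀ _hLK₀ => ?_⟩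
  obtain ⟨hK₆, hK₀1⟩ : K₆ ≤ K₀ ∧ 1 ≤ K₀ := by simp only [max_le_iff] at hK₀; exact hK₀
  -- the threshold
  obtain ⟨t, htdef⟩ : ∃ t : ℝ, t = min t₁ (min t₂ (min (tT K₀) (1 / (3 * ((d : ℝ) ^ 2 + 1))))) := ⟨_, rfl⟩
  have htpos : 0 < t := by
    rw [htdef]; refine lt_min ht₁ (lt_min ht₂ (lt_min (hTpos K₀).1 ?_)); positivity
  refine ⟨t, htpos, ?_⟩
  intro P S hPd hPL hK₀M h3M k hk1 hkK hs Ω hΩbig V Γ A δ hδ hreg ht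
  obtain ⟨j, rfl⟩ : ∃ j, k = j + 1 := ⟨k - 1, by omega⟩
  have ht' : ∀ u, t ≤ u → (P.L : ℝ) ^ (j + 1) * δ * |C.e| ≤ u := fun u hu => ht.trans hu
  have ht₁' := ht' t₁ (by rw [htdef]; exact min_le_left _ _)
  have ht₂' := ht' t₂ (by rw [htdef]; exact (min_le_right _ _).trans (min_le_left _ _))
  have htT := ht' (tT K₀) (by rw [htdef]; exact (min_le_right _ _).trans ((min_le_right _ _).trans (min_le_left _ _)))
  have ht3 := ht' (1 / (3 * ((d : ℝ) ^ 2 + 1))) (by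
    rw [htdef]; exact (min_le_right _ _).trans ((min_le_right _ _).trans (min_le_right _ _)))
  have hLpos : (0 : ℝ) < (P.L : ℝ) := by exact_mod_cast P.hL
  have hLk : (0 : ℝ) < (P.L : ℝ) ^ (j + 1) := pow_pos hLpos _
  have hmesh : 0 < P.mesh (j + 1) := P.mesh_pos _
  have hmeshk : P.mesh (j + 1) = (P.L : ℝ) ^ (j + 1) * P.mesh 0 := by unfold HiggsLattice.Params.mesh; ring
  -- r14's (2.27) smallness `d²·ε|e|·L^{2k}·δ ≤ 1∕3`
  have hsmall27 : (P.d : ℝ) ^ 2 * (P.mesh 0 * |C.e|) * ((P.L : ℝ) ^ (j + 1)) ^ 2 * δ ≤ 1 / 3 := by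
    have hu : 0 ≤ (P.L : ℝ) ^ (j + 1) * δ * |C.e| := by positivity
    have e1 : (P.d : ℝ) ^ 2 * (P.mesh 0 * |C.e|) * ((P.L : ℝ) ^ (j + 1)) ^ 2 * δ
        = (P.d : ℝ) ^ 2 * (P.mesh (j + 1) * ((P.L : ℝ) ^ (j + 1) * δ * |C.e|)) := by rw [hmeshk]; ring
    rw [e1]
    have e2 : P.mesh (j + 1) * ((P.L : ℝ) ^ (j + 1) * δ * |C.e|) ≤ 1 * (1 / (3 * ((d : ℝ) ^ 2 + 1))) :=
      mul_le_mul hs ht3 hu zero_le_one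
    rw [one_mul, ← hPd] at e2
    have e3 : (P.d : ℝ) ^ 2 * (1 / (3 * ((P.d : ℝ) ^ 2 + 1))) ≤ 1 / 3 := by
      rw [mul_div_assoc', mul_one, div_le_div_iff₀ (by positivity) (by norm_num)]
      nlinarith only [sq_nonneg (P.d : ℝ)]
    exact (mul_le_mul_of_nonneg_left e2 (by positivity)).trans e3
  -- the (2.27) exponent `δ27 = γ₀∕(4d + 4a)` and constant `c27`
  have hLr1 : (1 : ℝ) < (P.L : ℝ) := by rw [hPL]; exact_mod_cast hL1
  have hinv : ((P.L : ℝ) ^ 2)⁻¹ < 1 := inv_lt_one_of_one_lt₀ (one_lt_pow₀ hLr1 two_ne_zero)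
  have hγ₀pos : 0 < min 2 (a * (1 - ((P.L : ℝ) ^ 2)⁻¹) / 4) :=
    lt_min (by norm_num) (div_pos (mul_pos ha (by linarith only [hinv])) (by norm_num))
  have hden : (0 : ℝ) < 4 * P.d + 4 * a := by positivity
  obtain ⟨δ27, hδ27⟩ : ∃ δ27 : ℝ, δ27 = min 2 (a * (1 - ((P.L : ℝ) ^ 2)⁻¹) / 4) / (4 * P.d + 4 * a) := ⟨_, rfl⟩
  have hδ27pos : 0 < δ27 := by rw [hδ27]; exact div_pos hγ₀pos hden
  have hδ27adm : (4 * (P.d : ℝ) + 4 * a) * δ27 ≤ min 2 (a * (1 - ((P.L : ℝ) ^ 2)⁻¹) / 4) := by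
    rw [hδ27, mul_div_cancel₀ _ hden.ne']
  obtain ⟨c27, hc27⟩ : ∃ c27 : ℝ, c27 = a + a ^ 2 * (2 / min 2 (a * (1 - ((P.L : ℝ) ^ 2)⁻¹) / 4) * Real.exp δ27) := ⟨_, rfl⟩
  have hc27pos : 0 < c27 := by rw [hc27]; positivity
  have hn2nn : 0 ≤ (Fintype.card (Ix N) : ℝ) ^ 2 := by positivity
  have hcTpos := (hTpos K₀).2.1
  have hn27 : 0 ≤ (Fintype.card (Ix N) : ℝ) ^ 2 * c27 := mul_nonneg hn2nn hc27pos.le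
  have hn1 : 0 ≤ (Fintype.card (Ix N) : ℝ) ^ 2 * c₁ := mul_nonneg hn2nn hc₁.le
  have hn2T : 0 ≤ (Fintype.card (Ix N) : ℝ) ^ 2 * (c₂ + cT K₀) := mul_nonneg hn2nn (add_nonneg hc₂.le hcTpos.le)
  -- the region tower and (2.34), (2.38), (2.36), (2.27)
  have hΩΛ : ∀ x, x ∈ Ω ↔ blockIter (j + 1) x ∈ unitRegion (j + 1) Ω := mem_iff_blockIter_mem_unitRegion hΩbig
  have hLK' : P.L ∣ K₀ := by rw [hPL]; exact _hLK₀
  have hsatΩ := unitRegion_blockOf_sat hkK.le hLK' hΩbig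
  have hsatU := unitRegion_blockOf_sat hkK.le hLK' (isBigBlockUnion_univ (P := P) (K := j + 1) (K₀ := K₀))
  have hpΩ : pieceF (regTower (j := j) Ω) (Fin.last j) = Ω := pieceF_regTower hΩbig
  have hpU : pieceF (regTower (j := j) (Finset.univ : Finset (HiggsLattice.Site P 0))) (Fin.last j) = Finset.univ :=
    pieceF_regTower (K₀ := K₀) isBigBlockUnion_univ
  have hregδΩ : ∀ z ∈ pieceF (regTower (j := j) Ω) (Fin.last j), ∀ μ' ν : Fin P.d, |A ⟨z.shift ν, μ'⟩ - A ⟨z, μ'⟩| ≤ δ :=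
    fun z _ μ' ν => hreg z μ' ν
  have hregδU : ∀ z ∈ pieceF (regTower (j := j) (Finset.univ : Finset (HiggsLattice.Site P 0))) (Fin.last j), ∀ μ' ν : Fin P.d,
      |A ⟨z.shift ν, μ'⟩ - A ⟨z, μ'⟩| ≤ δ := fun z _ μ' ν => hreg z μ' ν
  have hsub : (regTower (j := j) Ω).block (Fin.last j) ⊆ (regTower (j := j) (Finset.univ : Finset (HiggsLattice.Site P 0))).block (Fin.last j) :=
    Finset.image_subset_image (Finset.subset_univ _)
  have hblk : (regTower (j := j) Ω).block (Fin.last j) = unitRegion (j + 1) Ω := rfl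
  have hCovT' := hCovT K₀ hK₆ P S hPd hPL hK₀M h3M hk1 hkK hs A hδ hreg htT
  have hΔ' := ineq227_regular_region_uniform C ha (by rw [hPL]; exact hL1) hmsq j hkK.le Ω (unitRegion (j + 1) Ω) hΩΛ A
    (fun z _ μ ν => hreg z μ ν) hsmall27 hδ27pos.le hδ27adm
  -- the constants
  refine ⟨(Fintype.card (Ix N) : ℝ) ^ 2 * c27 + (Fintype.card (Ix N) : ℝ) ^ 2 * c₁ + (Fintype.card (Ix N) : ℝ) ^ 2 * (c₂ + cT K₀) + 1,
    min δ27 (min δ₁ (min δ₂ (δT K₀))), by positivity, lt_min hδ27pos (lt_min hδ₁ (lt_min hδ₂ (hTpos K₀).2.2)), ?_⟩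
  intro Cc δ₀ hCc hδ₀pos hδ₀le
  have hCc0 : 0 ≤ Cc := by linarith only [hCc, hn27, hn1, hn2T]
  have hc27_le : (Fintype.card (Ix N) : ℝ) ^ 2 * c27 ≤ Cc := by linarith only [hCc, hn1, hn2T]
  have hc₁_le : (Fintype.card (Ix N) : ℝ) ^ 2 * c₁ ≤ Cc := by linarith only [hCc, hn27, hn2T]
  have hc₂T_le : (Fintype.card (Ix N) : ℝ) ^ 2 * (c₂ + cT K₀) ≤ Cc := by linarith only [hCc, hn27, hn1]
  have hδ₀_27 : δ₀ ≤ δ27 := hδ₀le.trans (min_le_left _ _)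
  have hδ₀_1 : δ₀ ≤ δ₁ := hδ₀le.trans ((min_le_right _ _).trans (min_le_left _ _))
  have hδ₀_2 : δ₀ ≤ δ₂ := hδ₀le.trans ((min_le_right _ _).trans ((min_le_right _ _).trans (min_le_left _ _)))
  have hδ₀_T : δ₀ ≤ δT K₀ := hδ₀le.trans ((min_le_right _ _).trans ((min_le_right _ _).trans (min_le_right _ _)))
  refine ⟨?_, ?_, ?_⟩
  · -- (3.6) `Δ^{(k)}(Ω, A)` ⇐ (2.27) on `Ω`
    intro x y
    show |P.mesh (j + 1) ^ 2 * blockNormK (deltaKA C Ω A msq a (j + 1)) x.1 y.1| ≤ Cc * Real.exp (-(δ₀ * (HiggsLattice.Site.tdist x.1 y.1 : ℝ)))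
    have hb := blockNormK_le (deltaKA C Ω A msq a (j + 1)) x.1 y.1
      (b := (P.mesh (j + 1))⁻¹ ^ 2 * c27 * Real.exp (-(δ27 * (HiggsLattice.Site.tdist x.1 y.1 : ℝ))))
      fun i i' => by rw [hc27]; exact hΔ' (x.1, i) (y.1, i') x.2 y.2
    rw [abs_of_nonneg (mul_nonneg (sq_nonneg _) (blockNormK_nonneg _ _ _))]
    have hs0 : 0 ≤ (HiggsLattice.Site.tdist x.1 y.1 : ℝ) := Nat.cast_nonneg _
    calc P.mesh (j + 1) ^ 2 * blockNormK (deltaKA C Ω A msq a (j + 1)) x.1 y.1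
        ≤ (Fintype.card (Ix N) : ℝ) ^ 2 * c27 * Real.exp (-(δ27 * (HiggsLattice.Site.tdist x.1 y.1 : ℝ))) := meshsq_mul_le_of_le hmesh hb
      _ ≤ Cc * Real.exp (-(δ₀ * (HiggsLattice.Site.tdist x.1 y.1 : ℝ))) := by
          simpa only [mul_one] using weight_mono_region (M := 1) hc27_le hCc0 hδ₀_27 hs0 zero_le_one
  · -- (3.6) `C^{(k)}(Ω, A)` ⇐ (2.34) on `Ω`
    intro x y
    show |(P.mesh (j + 1) ^ 2)⁻¹ * blockNormK (condCov232 C Ω A msq a (j + 1) (unitRegion (j + 1) Ω)) x.1 y.1|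
        ≤ Cc * Real.exp (-(δ₀ * (HiggsLattice.Site.tdist x.1 y.1 : ℝ)))
    have hb := blockNormK_le (condCov232 C Ω A msq a (j + 1) (unitRegion (j + 1) Ω)) x.1 y.1
      (b := P.mesh (j + 1) ^ 2 * c₁ * Real.exp (-(δ₁ * (HiggsLattice.Site.tdist x.1 y.1 : ℝ))))
      fun i i' => by
        have h := (hCov C P hPd hPL (regTower (j := j) Ω) hkK.le (Fin.last j) hkK hs hsatΩ A hδ hregδΩ ht₁'
          (Λ := unitRegion (j + 1) Ω) le_rfl (p := (x.1, i)) (q := (y.1, i')) x.2 y.2).1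
        rw [hpΩ] at h
        simpa using h
    rw [abs_of_nonneg (mul_nonneg (inv_nonneg.2 (sq_nonneg _)) (blockNormK_nonneg _ _ _))]
    have hs0 : 0 ≤ (HiggsLattice.Site.tdist x.1 y.1 : ℝ) := Nat.cast_nonneg _
    calc (P.mesh (j + 1) ^ 2)⁻¹ * blockNormK (condCov232 C Ω A msq a (j + 1) (unitRegion (j + 1) Ω)) x.1 y.1
        ≤ (Fintype.card (Ix N) : ℝ) ^ 2 * c₁ * Real.exp (-(δ₁ * (HiggsLattice.Site.tdist x.1 y.1 : ℝ))) := inv_meshsq_mul_le_of_le hmesh hb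
      _ ≤ Cc * Real.exp (-(δ₀ * (HiggsLattice.Site.tdist x.1 y.1 : ℝ))) := by
          simpa only [mul_one] using weight_mono_region (M := 1) hc₁_le hCc0 hδ₀_1 hs0 zero_le_one
  · -- `δC^{(k)}(Ω, A)` — LIVE: (2.38) + (2.36)
    intro x y
    show |(P.mesh (j + 1) ^ 2)⁻¹ * blockNormK (condCov232 C Ω A msq a (j + 1) (unitRegion (j + 1) Ω)
            - condCov232 C Finset.univ A msq a (j + 1) Finset.univ) x.1 y.1|
        ≤ Cc * Real.exp (-(δ₀ * (HiggsLattice.Site.tdist x.1 y.1 : ℝ))) *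
          Real.exp (-(δ₀ * min (distC (unitRegion (j + 1) Ω) x.1) (distC (unitRegion (j + 1) Ω) y.1)))
    have hsplit : condCov232 C Ω A msq a (j + 1) (unitRegion (j + 1) Ω) - condCov232 C Finset.univ A msq a (j + 1) Finset.univ
        = (condCov232 C Ω A msq a (j + 1) (unitRegion (j + 1) Ω) - condCov232 C Finset.univ A msq a (j + 1) (unitRegion (j + 1) Ω))
          + (condCov232 C Finset.univ A msq a (j + 1) (unitRegion (j + 1) Ω) - condCov232 C Finset.univ A msq a (j + 1) Finset.univ) :=
      (sub_add_sub_cancel _ _ _).symm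
    have h235 : condCov232 C Finset.univ A msq a (j + 1) (unitRegion (j + 1) Ω) - condCov232 C Finset.univ A msq a (j + 1) Finset.univ
        = deltaCov235 C Finset.univ A msq a (j + 1) (unitRegion (j + 1) Ω) := by
      show _ = condCov232 C Finset.univ A msq a (j + 1) (unitRegion (j + 1) Ω) - fluctCovA C Finset.univ A msq a (j + 1)
      rw [← condCov232_univ]
    have hs0 : 0 ≤ (HiggsLattice.Site.tdist x.1 y.1 : ℝ) := Nat.cast_nonneg _
    have hu : 0 ≤ distC (unitRegion (j + 1) Ω) x.1 := distC_nonneg _ _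
    have hv : 0 ≤ distC (unitRegion (j + 1) Ω) y.1 := distC_nonneg _ _
    have hss : 0 ≤ (HiggsLattice.Site.tdist x.1 y.1 : ℝ) + distC (unitRegion (j + 1) Ω) x.1 + distC (unitRegion (j + 1) Ω) y.1 :=
      add_nonneg (add_nonneg hs0 hu) hv
    have hb1 := blockNormK_le
      (condCov232 C Ω A msq a (j + 1) (unitRegion (j + 1) Ω) - condCov232 C Finset.univ A msq a (j + 1) (unitRegion (j + 1) Ω)) x.1 y.1
      (b := P.mesh (j + 1) ^ 2 * c₂ * Real.exp (-(δ₂ *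
        ((HiggsLattice.Site.tdist x.1 y.1 : ℝ) + distC (unitRegion (j + 1) Ω) x.1 + distC (unitRegion (j + 1) Ω) y.1))))
      fun i i' => by
        have h := hCov238 C P hPd hPL (regTower (j := j) Ω) (regTower (j := j) Finset.univ) hkK.le (Fin.last j) hkK hs hsatΩ hsatU hsub
          A hδ hregδU ht₂' (Λ := unitRegion (j + 1) Ω) le_rfl (p := (x.1, i)) (q := (y.1, i')) x.2 y.2
        rw [hpΩ, hpU, hblk] at h
        rw [mat_sub_apply]
        simpa using h
    have hb2 := blockNormK_le
      (condCov232 C Finset.univ A msq a (j + 1) (unitRegion (j + 1) Ω) - condCov232 C Finset.univ A msq a (j + 1) Finset.univ) x.1 y.1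
      (b := P.mesh (j + 1) ^ 2 * cT K₀ * Real.exp (-(δT K₀ *
        ((HiggsLattice.Site.tdist x.1 y.1 : ℝ) + distC (unitRegion (j + 1) Ω) x.1 + distC (unitRegion (j + 1) Ω) y.1))))
      fun i i' => by
        rw [h235]
        simpa using (hCovT' (unitRegion (j + 1) Ω) (p := (x.1, i)) (q := (y.1, i')) x.2 y.2).2
    rw [abs_of_nonneg (mul_nonneg (inv_nonneg.2 (sq_nonneg _)) (blockNormK_nonneg _ _ _)), hsplit]
    have hexp2 : Real.exp (-(δ₂ * ((HiggsLattice.Site.tdist x.1 y.1 : ℝ) + distC (unitRegion (j + 1) Ω) x.1 + distC (unitRegion (j + 1) Ω) y.1)))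
        ≤ Real.exp (-(δ₀ * ((HiggsLattice.Site.tdist x.1 y.1 : ℝ) + distC (unitRegion (j + 1) Ω) x.1 + distC (unitRegion (j + 1) Ω) y.1))) :=
      Real.exp_le_exp.2 (neg_le_neg (mul_le_mul_of_nonneg_right hδ₀_2 hss))
    have hexpT : Real.exp (-(δT K₀ * ((HiggsLattice.Site.tdist x.1 y.1 : ℝ) + distC (unitRegion (j + 1) Ω) x.1 + distC (unitRegion (j + 1) Ω) y.1)))
        ≤ Real.exp (-(δ₀ * ((HiggsLattice.Site.tdist x.1 y.1 : ℝ) + distC (unitRegion (j + 1) Ω) x.1 + distC (unitRegion (j + 1) Ω) y.1))) :=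
      Real.exp_le_exp.2 (neg_le_neg (mul_le_mul_of_nonneg_right hδ₀_T hss))
    calc (P.mesh (j + 1) ^ 2)⁻¹ * blockNormK
          ((condCov232 C Ω A msq a (j + 1) (unitRegion (j + 1) Ω) - condCov232 C Finset.univ A msq a (j + 1) (unitRegion (j + 1) Ω))
          + (condCov232 C Finset.univ A msq a (j + 1) (unitRegion (j + 1) Ω) - condCov232 C Finset.univ A msq a (j + 1) Finset.univ)) x.1 y.1
        ≤ (P.mesh (j + 1) ^ 2)⁻¹ *
            (blockNormK (condCov232 C Ω A msq a (j + 1) (unitRegion (j + 1) Ω) - condCov232 C Finset.univ A msq a (j + 1) (unitRegion (j + 1) Ω)) x.1 y.1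
            + blockNormK (condCov232 C Finset.univ A msq a (j + 1) (unitRegion (j + 1) Ω) - condCov232 C Finset.univ A msq a (j + 1) Finset.univ) x.1 y.1) :=
          mul_le_mul_of_nonneg_left (blockNormK_add_le _ _ _ _) (inv_nonneg.2 (sq_nonneg _))
      _ ≤ (Fintype.card (Ix N) : ℝ) ^ 2 * c₂ * Real.exp (-(δ₂ *
              ((HiggsLattice.Site.tdist x.1 y.1 : ℝ) + distC (unitRegion (j + 1) Ω) x.1 + distC (unitRegion (j + 1) Ω) y.1)))
          + (Fintype.card (Ix N) : ℝ) ^ 2 * cT K₀ * Real.exp (-(δT K₀ *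
              ((HiggsLattice.Site.tdist x.1 y.1 : ℝ) + distC (unitRegion (j + 1) Ω) x.1 + distC (unitRegion (j + 1) Ω) y.1))) := by
          rw [mul_add]; exact add_le_add (inv_meshsq_mul_le_of_le hmesh hb1) (inv_meshsq_mul_le_of_le hmesh hb2)
      _ ≤ (Fintype.card (Ix N) : ℝ) ^ 2 * c₂ * Real.exp (-(δ₀ *
              ((HiggsLattice.Site.tdist x.1 y.1 : ℝ) + distC (unitRegion (j + 1) Ω) x.1 + distC (unitRegion (j + 1) Ω) y.1)))
          + (Fintype.card (Ix N) : ℝ) ^ 2 * cT K₀ * Real.exp (-(δ₀ *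
              ((HiggsLattice.Site.tdist x.1 y.1 : ℝ) + distC (unitRegion (j + 1) Ω) x.1 + distC (unitRegion (j + 1) Ω) y.1))) :=
          add_le_add (mul_le_mul_of_nonneg_left hexp2 (mul_nonneg hn2nn hc₂.le))
            (mul_le_mul_of_nonneg_left hexpT (mul_nonneg hn2nn hcTpos.le))
      _ = (Fintype.card (Ix N) : ℝ) ^ 2 * (c₂ + cT K₀) * Real.exp (-(δ₀ *
              ((HiggsLattice.Site.tdist x.1 y.1 : ℝ) + distC (unitRegion (j + 1) Ω) x.1 + distC (unitRegion (j + 1) Ω) y.1))) := by ring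
      _ ≤ Cc * Real.exp (-(δ₀ *
              ((HiggsLattice.Site.tdist x.1 y.1 : ℝ) + distC (unitRegion (j + 1) Ω) x.1 + distC (unitRegion (j + 1) Ω) y.1))) :=
          mul_le_mul_of_nonneg_right hc₂T_le (Real.exp_nonneg _)
      _ ≤ Cc * (Real.exp (-(δ₀ * (HiggsLattice.Site.tdist x.1 y.1 : ℝ))) *
            Real.exp (-(δ₀ * min (distC (unitRegion (j + 1) Ω) x.1) (distC (unitRegion (j + 1) Ω) y.1)))) :=
          mul_le_mul_of_nonneg_left (exp_sum_le_min_region hδ₀pos.le hv) hCc0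
      _ = _ := by ring

end Summit.QuantumFields.YangMills.BalabanUVNodes.N15KingModelRung.Curved

end
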